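import Mathlib
import Summits.MatrixMultiplication.MatrixMultiplication.Theses.NilpotentLieHosts

/-!
# Crux `UnitriangularCostShape` (stmt-MatrixMultiplication-7724) — `Lines/birth.lean`, the BC3 birth skeleton

Route `NilpotentLieHosts`, crux #5 `UnitriangularCostShape` (card C2, the cost numerology of the
unitriangular tower): for every `d ≥ 3` there are `b > 0` and `C` with
`(|X||Y||Z|)^(ω/3) ≤ C (s+1)^(((D-b)/2)·ω + b)`, `D = d(d-1)/2`, for every TPP triple in `U_d(ℤ)` with
separating polynomials of `(j-i)`-weighted degree `≤ s`.

Decomposition along the route's own mechanism (BCGPU24 Rem. 2.4 "price = cost of the image algebra",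
made concrete as a matrix algebra over a truncated Casimir algebra — the route header's TWO-LAYER PLAN
`… → HeisenbergHosting → TruncatedMatrixAlgebraCost`, one dimension up).  Write
`R_{k,t} := ℂ[z₁,…,z_k]/(z₁^t,…,z_k^t)` (inline:
`MvPolynomial (Fin k) ℂ ⧸ Ideal.span (Set.range fun i => X i ^ t)`, dimension `t^k`).

* `stub_productModel` (XL — the load-bearing, OPEN stub; `d = 3` is the Heisenberg case, provable with
  `b = 1, k = 1, t = s+1, N = 2s+1` from the truncated Schrödinger–Fock module `W = ℂ[z,u]/(wt ≥ 2s+1)`,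
  `e₁₂ ↦ z∂_u, e₂₃ ↦ u, e₁₃ ↦ z`, presented as a quotient of the free module `R^N`, `R = ℂ[z]/z^(s+1)`):
  a WEYL-TYPE PRODUCT MODEL — for every `d ≥ 3` there are `b > 0`, a number `k` of Casimir variables and
  `c > 0` such that for every budget `s` there are `t, N` with `N ≤ c (s+1)^((D-b)/2)`, `t^k ≤ c (s+1)^b`,
  a map `ρ : SL_d(ℤ) → M_N(R_{k,t})` and, for every polynomial `p` of weighted degree `≤ s`, a `ℂ`-linear
  functional `ℓ` on `M_N(R_{k,t})` reading `p` on PRODUCTS: `ℓ (ρ g · ρ h) = p(g h)` for all upper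
  unitriangular `g, h`.  (This is exactly what a `U(u_d)`-module with `N` generators over the truncated
  Casimir ring, faithful up to weight `s`, provides: its image algebra is a subquotient `S/J` of
  `M_N(R_{k,t})`, `ρ` = any linear lift, `ℓ` = matrix coefficient ∘ projection; no multiplicativity of
  `ρ` itself is asked — a free model is obstructed by `tr [P,Q] = 0`.)  Expected `b = k = ⌊d/2⌋ =`
  index of `u_d` (Dixmier: the centre of `U(u_d)` is polynomial in `⌊d/2⌋` generators; Gelfand–Kirillov
  `2a + b = D`).
* `stub_modelHosts` (M, provable now — the BCGPU24 Thm 2.2 / Rem 2.4 mechanism): a product model at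
  level `s` turns every unitriangular triple `X, Y, Z` with weighted-degree-`≤ s` separating polynomials
  into a HOSTING of `⟨|X|,|Y|,|Z|⟩` in `M_N(R_{k,t})`: `α(M) = Σ M_{xy} ρ(x y⁻¹)`,
  `β(M') = Σ M'_{y'z} ρ(y' z⁻¹)`, `γ = (ℓ_{p_{x₀z₀}})_{x₀,z₀}`, and `γ(α(M) β(M')) = M M'` by the
  separation pattern (the TPP hypothesis of the crux is not even needed here).
* `stub_truncatedMatrixCost` (M–L, provable now): hosting in `M_N(R_{k,t})` is priced at
  `κ_k · N^ω · t^k` — the route's PROVED support item `HostingBound`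
  (`Theorems.hostingBound_proof`: hosting ⇒ `(nlp)^(ω/3) ≤ R̃(T_A)`) plus
  `R̃(T_{M_N(R)}) ≤ R̃⟨N,N,N⟩ · R̃(T_R) = N^ω · R̃(T_R)` (`asymptoticRank_kronecker_le`,
  `asymptoticRank_matMulTensor`) and `R̃(T_{ℂ[z]/z^t}) ≤ t` (border rank `t`, Bini; or `≤ 2t - 1` by
  embedding into a cyclic group algebra — whence the slack constant `κ_k`, e.g. `2^k`).

`UnitriangularCostShape_of` composes the three stubs into the crux BY NAME with a real proof (exponent
bookkeeping over `ℝ`: `κ N^ω t^k ≤ κ (c (s+1)^A)^ω · c (s+1)^b = (κ c^ω c) (s+1)^(A ω + b)`,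
`A = (D - b)/2`; no `sorry` outside `stub_*`).  Disproof used: no `Disproof.lean` / `Negative/` lemma
exists for this crux (`ledger crux ls`: no workfiles); negatives index of the summit does not touch it.
-/

set_option linter.dupNamespace false

namespace Summit.MatrixMultiplication.MatrixMultiplication.Cruxes.UnitriangularCostShape.Birth

open scoped BigOperators Matrix

/-- STUB 1 — WEYL-TYPE PRODUCT MODEL of `U(u_d)/I^(s+1)` over a truncated Casimir algebra (the
load-bearing, open stub; `d = 3`: Heisenberg, `b = 1`).  For every `d ≥ 3` there are `b > 0`, `k` and
`c > 0` such that for every `s` some `t, N` with `N ≤ c (s+1)^((d(d-1)/2 - b)/2)` and `t^k ≤ c (s+1)^b`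
carry a map `ρ : SL_d(ℤ) → M_N(ℂ[z₁..z_k]/(zᵢ^t))` whose products are read by linear functionals:
every polynomial in the matrix entries of `(j-i)`-weighted degree `≤ s` is `g h ↦ ℓ (ρ g * ρ h)` on
pairs of upper unitriangular `g, h`. -/
theorem stub_productModel :
    ∀ d : ℕ, 3 ≤ d → ∃ b : ℝ, 0 < b ∧ ∃ k : ℕ, ∃ c : ℝ, 0 < c ∧ ∀ s : ℕ, ∃ t N : ℕ,
      (N : ℝ) ≤ c * ((s : ℝ) + 1) ^ (((d : ℝ) * (d - 1) / 2 - b) / 2) ∧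
      (t : ℝ) ^ k ≤ c * ((s : ℝ) + 1) ^ b ∧
      ∃ ρ : Matrix.SpecialLinearGroup (Fin d) ℤ →
          Matrix (Fin N) (Fin N) (MvPolynomial (Fin k) ℂ ⧸
            Ideal.span (Set.range fun i : Fin k => (MvPolynomial.X i : MvPolynomial (Fin k) ℂ) ^ t)),
        ∀ p : MvPolynomial (Fin d × Fin d) ℂ,
          MvPolynomial.weightedTotalDegree (fun ij : Fin d × Fin d => (ij.2 : ℕ) - ij.1) p ≤ s →
          ∃ ℓ : Matrix (Fin N) (Fin N) (MvPolynomial (Fin k) ℂ ⧸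
              Ideal.span (Set.range fun i : Fin k => (MvPolynomial.X i : MvPolynomial (Fin k) ℂ) ^ t))
              →ₗ[ℂ] ℂ,
            ∀ g h : Matrix.SpecialLinearGroup (Fin d) ℤ,
              (∀ i j : Fin d, j ≤ i → (g : Matrix (Fin d) (Fin d) ℤ) i j = if i = j then 1 else 0) →
              (∀ i j : Fin d, j ≤ i → (h : Matrix (Fin d) (Fin d) ℤ) i j = if i = j then 1 else 0) →
              ℓ (ρ g * ρ h) = MvPolynomial.eval (fun ij : Fin d × Fin d =>
                (((g * h : Matrix.SpecialLinearGroup (Fin d) ℤ) : Matrix (Fin d) (Fin d) ℤ) ij.1 ij.2 : ℂ)) p := by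
  sorry

/-- STUB 2 — A PRODUCT MODEL HOSTS SEPARATED TRIPLES (BCGPU24 Thm 2.2 / Rem 2.4 mechanism, provable
now).  Given `ρ, ℓ` as in Stub 1 at level `s` and upper unitriangular `X, Y, Z ⊂ SL_d(ℤ)` with
separating polynomials of weighted degree `≤ s` (the crux's hypothesis verbatim), the matrix
multiplication tensor `⟨|X|,|Y|,|Z|⟩` is hosted by `M_N(ℂ[z₁..z_k]/(zᵢ^t))`:
`α(M) = Σ M_{xy} ρ(x y⁻¹)`, `β(M') = Σ M'_{y'z} ρ(y' z⁻¹)`, `γ = (ℓ_{x₀z₀})`, `γ(α(M) β(M')) = M M'`. -/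
theorem stub_modelHosts :
    ∀ (d k t N s : ℕ)
      (ρ : Matrix.SpecialLinearGroup (Fin d) ℤ →
        Matrix (Fin N) (Fin N) (MvPolynomial (Fin k) ℂ ⧸
          Ideal.span (Set.range fun i : Fin k => (MvPolynomial.X i : MvPolynomial (Fin k) ℂ) ^ t)))
      (X Y Z : Finset (Matrix.SpecialLinearGroup (Fin d) ℤ)),
      (∀ p : MvPolynomial (Fin d × Fin d) ℂ,
          MvPolynomial.weightedTotalDegree (fun ij : Fin d × Fin d => (ij.2 : ℕ) - ij.1) p ≤ s →
          ∃ ℓ : Matrix (Fin N) (Fin N) (MvPolynomial (Fin k) ℂ ⧸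
              Ideal.span (Set.range fun i : Fin k => (MvPolynomial.X i : MvPolynomial (Fin k) ℂ) ^ t))
              →ₗ[ℂ] ℂ,
            ∀ g h : Matrix.SpecialLinearGroup (Fin d) ℤ,
              (∀ i j : Fin d, j ≤ i → (g : Matrix (Fin d) (Fin d) ℤ) i j = if i = j then 1 else 0) →
              (∀ i j : Fin d, j ≤ i → (h : Matrix (Fin d) (Fin d) ℤ) i j = if i = j then 1 else 0) →
              ℓ (ρ g * ρ h) = MvPolynomial.eval (fun ij : Fin d × Fin d =>
                (((g * h : Matrix.SpecialLinearGroup (Fin d) ℤ) : Matrix (Fin d) (Fin d) ℤ) ij.1 ij.2 : ℂ)) p) →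
      (∀ g ∈ X ∪ Y ∪ Z, ∀ i j : Fin d, j ≤ i → (g : Matrix (Fin d) (Fin d) ℤ) i j = if i = j then 1 else 0) →
      (∀ x₀ ∈ X, ∀ z₀ ∈ Z, ∃ p : MvPolynomial (Fin d × Fin d) ℂ,
          MvPolynomial.weightedTotalDegree (fun ij : Fin d × Fin d => (ij.2 : ℕ) - ij.1) p ≤ s ∧
          ∀ x ∈ X, ∀ y ∈ Y, ∀ y' ∈ Y, ∀ z ∈ Z,
            MvPolynomial.eval (fun ij : Fin d × Fin d =>
              (((x * y⁻¹ * y' * z⁻¹ : Matrix.SpecialLinearGroup (Fin d) ℤ) : Matrix (Fin d) (Fin d) ℤ)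
                ij.1 ij.2 : ℂ)) p = if x = x₀ ∧ y = y' ∧ z = z₀ then 1 else 0) →
      ∃ (α : Matrix (Fin X.card) (Fin Y.card) ℂ →ₗ[ℂ]
            Matrix (Fin N) (Fin N) (MvPolynomial (Fin k) ℂ ⧸
              Ideal.span (Set.range fun i : Fin k => (MvPolynomial.X i : MvPolynomial (Fin k) ℂ) ^ t)))
        (β : Matrix (Fin Y.card) (Fin Z.card) ℂ →ₗ[ℂ]
            Matrix (Fin N) (Fin N) (MvPolynomial (Fin k) ℂ ⧸
              Ideal.span (Set.range fun i : Fin k => (MvPolynomial.X i : MvPolynomial (Fin k) ℂ) ^ t)))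
        (γ : Matrix (Fin N) (Fin N) (MvPolynomial (Fin k) ℂ ⧸
              Ideal.span (Set.range fun i : Fin k => (MvPolynomial.X i : MvPolynomial (Fin k) ℂ) ^ t))
            →ₗ[ℂ] Matrix (Fin X.card) (Fin Z.card) ℂ),
        ∀ (M : Matrix (Fin X.card) (Fin Y.card) ℂ) (M' : Matrix (Fin Y.card) (Fin Z.card) ℂ),
          γ (α M * β M') = M * M' := by
  sorry

/-- STUB 3 — COST OF THE TRUNCATED MATRIX HOST (provable now).  For every number `k` of Casimir
variables there is `κ > 0` (e.g. `2^k`; in truth `1`, by Bini's border rank `t` of `ℂ[z]/z^t`) such that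
any hosting of `⟨n,l,p⟩` in `M_N(ℂ[z₁..z_k]/(zᵢ^t))` forces `(n l p)^(ω/3) ≤ κ · N^ω · t^k` — the
route's proved `HostingBound` (`Theorems.hostingBound_proof`), `R̃(s ⊠ t) ≤ R̃(s) R̃(t)`
(`asymptoticRank_kronecker_le`), `R̃⟨N,N,N⟩ = N^ω` (`asymptoticRank_matMulTensor`) and
`R̃(T_{ℂ[z]/z^t}) ≤ t` (resp. `≤ 2t - 1` inside a cyclic group algebra). -/
theorem stub_truncatedMatrixCost :
    ∀ k : ℕ, ∃ κ : ℝ, 0 < κ ∧ ∀ (t N n l p : ℕ)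
      (α : Matrix (Fin n) (Fin l) ℂ →ₗ[ℂ]
          Matrix (Fin N) (Fin N) (MvPolynomial (Fin k) ℂ ⧸
            Ideal.span (Set.range fun i : Fin k => (MvPolynomial.X i : MvPolynomial (Fin k) ℂ) ^ t)))
      (β : Matrix (Fin l) (Fin p) ℂ →ₗ[ℂ]
          Matrix (Fin N) (Fin N) (MvPolynomial (Fin k) ℂ ⧸
            Ideal.span (Set.range fun i : Fin k => (MvPolynomial.X i : MvPolynomial (Fin k) ℂ) ^ t)))
      (γ : Matrix (Fin N) (Fin N) (MvPolynomial (Fin k) ℂ ⧸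
            Ideal.span (Set.range fun i : Fin k => (MvPolynomial.X i : MvPolynomial (Fin k) ℂ) ^ t))
          →ₗ[ℂ] Matrix (Fin n) (Fin p) ℂ),
      (∀ (M : Matrix (Fin n) (Fin l) ℂ) (M' : Matrix (Fin l) (Fin p) ℂ), γ (α M * β M') = M * M') →
      ((n * l * p : ℕ) : ℝ) ^ (Literature.Computability.AlgebraicComplexity.omega ℂ / 3) ≤
        κ * (N : ℝ) ^ Literature.Computability.AlgebraicComplexity.omega ℂ * (t : ℝ) ^ k := by
  sorry

/-- COMPOSITION (real proof, no `sorry` of its own): model ∘ hosting ∘ cost, then exponent bookkeeping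
over `ℝ` — `κ N^ω t^k ≤ κ (c (s+1)^A)^ω · c (s+1)^b = (κ c^ω c) · (s+1)^(A ω + b)` with
`A = (d(d-1)/2 - b)/2`; the constant `C := κ c^ω c` does not depend on `s` because `k` (hence `κ`) and
`c` are chosen per `d`.  Concludes the crux `UnitriangularCostShape` BY NAME. -/
theorem UnitriangularCostShape_of :
    Summit.MatrixMultiplication.MatrixMultiplication.Theses.NilpotentLieHosts.UnitriangularCostShape := by
  intro d hd
  obtain ⟨b, hb, k, c, hc, hmodel⟩ := stub_productModel d hd
  obtain ⟨κ, hκ, hcostk⟩ := stub_truncatedMatrixCost k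
  refine ⟨b, hb, κ * c ^ Literature.Computability.AlgebraicComplexity.omega ℂ * c, ?_⟩
  intro s X Y Z hU _hT hS
  obtain ⟨t, N, hN, ht, ρ, hρ⟩ := hmodel s
  obtain ⟨α, β, γ, hhost⟩ := stub_modelHosts d k t N s ρ X Y Z hρ hU hS
  have hcost := hcostk t N X.card Y.card Z.card α β γ hhost
  set w : ℝ := Literature.Computability.AlgebraicComplexity.omega ℂ with hw
  set A : ℝ := ((d : ℝ) * (d - 1) / 2 - b) / 2 with hA
  have hw0 : 0 ≤ w :=
    zero_le_two.trans (Literature.Computability.AlgebraicComplexity.omega_two_le ℂ)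
  have hs0 : (0 : ℝ) < (s : ℝ) + 1 := by positivity
  have hsA : (0 : ℝ) ≤ ((s : ℝ) + 1) ^ A := Real.rpow_nonneg hs0.le A
  have hcw : (0 : ℝ) ≤ c ^ w := Real.rpow_nonneg hc.le w
  have h1 : (N : ℝ) ^ w ≤ c ^ w * ((s : ℝ) + 1) ^ (A * w) :=
    calc (N : ℝ) ^ w ≤ (c * ((s : ℝ) + 1) ^ A) ^ w := Real.rpow_le_rpow (Nat.cast_nonneg N) hN hw0
      _ = c ^ w * (((s : ℝ) + 1) ^ A) ^ w := Real.mul_rpow hc.le hsA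
      _ = c ^ w * ((s : ℝ) + 1) ^ (A * w) := by rw [Real.rpow_mul hs0.le]
  have h2 : (N : ℝ) ^ w * (t : ℝ) ^ k ≤
      (c ^ w * ((s : ℝ) + 1) ^ (A * w)) * (c * ((s : ℝ) + 1) ^ b) :=
    mul_le_mul h1 ht (by positivity) (mul_nonneg hcw (Real.rpow_nonneg hs0.le _))
  have h3 : κ * ((c ^ w * ((s : ℝ) + 1) ^ (A * w)) * (c * ((s : ℝ) + 1) ^ b)) =
      κ * c ^ w * c * ((s : ℝ) + 1) ^ (A * w + b) := by
    rw [Real.rpow_add hs0]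
    ring
  have hcard : ((X.card * Y.card * Z.card : ℕ) : ℝ) = (X.card : ℝ) * Y.card * Z.card := by
    simp only [Nat.cast_mul]
  calc ((X.card : ℝ) * Y.card * Z.card) ^ (w / 3)
      = ((X.card * Y.card * Z.card : ℕ) : ℝ) ^ (w / 3) := by rw [hcard]
    _ ≤ κ * (N : ℝ) ^ w * (t : ℝ) ^ k := hcost
    _ = κ * ((N : ℝ) ^ w * (t : ℝ) ^ k) := by ring
    _ ≤ κ * ((c ^ w * ((s : ℝ) + 1) ^ (A * w)) * (c * ((s : ℝ) + 1) ^ b)) :=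
      mul_le_mul_of_nonneg_left h2 hκ.le
    _ = κ * c ^ w * c * ((s : ℝ) + 1) ^ (A * w + b) := h3

end Summit.MatrixMultiplication.MatrixMultiplication.Cruxes.UnitriangularCostShape.Birth
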